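/-
Copyright (c) 2026 the pub-hodgecm-mathlib formalisation cell (harness21).  Prover seat hodgecm-mathlib-B-p14 (g33), 2026-09-01.  Road «W′» = «R1LL-WILD»
(architect A-p16 (g28), census W′-v1 §5: «B-p14 (g33): (W′2) C — CM ∕ ρ dress»): the unfolding of a localised orbital integral on `H_v = U(Φ₂)(L⁺_v) × U(Φ₁)(L⁺_v)`
down to the FIXED VERTICES of the tree of `SL₂(L⁺_v)` under `ρ_w`, and its shell form.
-/
import Literature.NumberTheory.Rogawski1990.RankOneKappaOrbitalUnfoldingH              -- ★ I-7 p843491 (A-p16): the `H_v` carrier, `integral_conj_eq_smul_finsum_onePlace` (coset currency; this file is its vertex twin)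
import Literature.NumberTheory.Automorphic.UnitaryTwoRamifiedTreeAction                 -- ★ (W1c)-B place level p843857 (B-p08): `rhoVertexActPlace`, `_one`, `_mul`, `exists_rhoVertexActPlace_eq`
import Literature.NumberTheory.Automorphic.OrbitalIntegralFixedPointWeightedActionProd  -- ★ p843965 (this seat, (W′2) C generic): `integral_conj_eq_smul_finsum_fixedPoints_of_vertexAction_prod`, `…_sum_shells_…_prod`
import Literature.NumberTheory.Automorphic.OrbitalIntegralCosetUnfolding               -- ★ p844020∕p844051 (this seat, (Ψ1) generic): `integral_conj_eq_sum_ncard_shell_smul_of_vertexAction_haar` (general `f`, no support condition)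
import HarnessLib

/-!
# The unfolding of a localised orbital integral on `H_v = U(Φ₂)(L⁺_v) × U(Φ₁)(L⁺_v)` down to the fixed VERTICES of the tree of `SL₂(L⁺_v)` (road «W′», (W′2) C)

Topic `NumberTheory/Rogawski1990`; namespace `Literature.NumberTheory.Rogawski1990` (sibling of ★ I-7 `RankOneKappaOrbitalUnfoldingH`, whose `…_onePlace` head this
file continues from the cosets `↥U_w ⧸ K′` to the vertices of the tree).  THEOREMS ONLY (no definition, no instance, no notation, no named fact, no `sorry`); kernel lane.
Cell `pub/hodgecm-mathlib`, crux H413 = `stmt-HodgeConjecture-24833`; road «W′» = «R1LL-WILD» (the wildly ramified residue `RankOneUnstableTransferNonsplitCMERamifiedWild`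
of books row #159 ∕ #165; LEAD F0P3a-plan (g10) WORD T9-25; architect A-p16 (g28), census W′-v1 §1 «`hD`, `hΨ` ⟸ THE TREE SIDE … (W′2) unfolding through `ρ`»).
HONEST LABEL: HC_CM is proved only modulo the cell's 2 remaining named inputs (hLiu418, h413) until rung 0 closes; this file is transport and asserts nothing printed.

THE MATHEMATICS [Rogawski1990 §4.9 p. 54; LabesseLanglands1979 §2 p. 8; Kottwitz1986 §3].  At a non-split place `w ∣ v`, `U_w = U(σ_w, (Φ₂)_w)(L_w)` acts on the
vertices of the tree `X` of `SL₂(L⁺_v)` by `ρ_w` (★ `rhoVertexActPlace`), with ONE vertex orbit at a RAMIFIED place; along a one-place model `E₂ : U(Φ₂)(L⁺_v) ≃ₜ* ↥U_w`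
the group `H_v = U(Φ₂)(L⁺_v) × U(Φ₁)(L⁺_v)` acts through its first factor, and for a level `K ≤ U(Φ₂)(L⁺_v)` that IS the stabiliser of the root (`g ∈ K ↔ ρ_w(E₂ g)·x₀ = x₀`,
★ `UnitaryTwoRamifiedTreeStabilizersPlace` by type) the orbital integral `∫_{H_v} φ(y x y⁻¹) dν(y)` unfolds onto the vertices: for `φ` supported in `K × U(Φ₁)_v` and
`Ad`-invariant it is `ν(K × U(Φ₁)_v) · Σ_{M fixed} val M` (§1, value-law ∕ shell forms over ★ (W′2) C generic), and for a GENERAL `f` (§2, over ★ `OrbitalIntegralCosetUnfolding`)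
it is the SHELL SUM `Σ_{m} #{M ∈ SV | d M = m} • f̄_m(x)` with `f̄_m` the `K × U(Φ₁)_v`-average at the `m`-th shell representative — Labesse–Langlands'
`Σ_m C_m(γ) · f(α_m⁻¹ γ α_m)` ((W′0) §B2; counts `C_m = 2q^m` = (W′1) ★, classes = (W′3)).  Every object is ROAD W's by name (census W′-v1 (I4)); masses symbolic (I6);
`K`, `d`, `rU`, `SV`, `val` stay binders for the assembler.

* `integral_conj_eq_smul_finsum_fixedVertices_onePlace` (value-law form), `integral_conj_eq_smul_sum_shells_onePlace` (shell form),
  `finite_fixedBy_quotient_prod_iff_fixedVertices_onePlace` (the `hfin` currency of ★ I-7 ↔ finitely many fixed vertices).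
* §2 (ED. 2; RULING A-37 socket (Ψ1), GENERAL `f`, NO support condition, NO pieces — (W′0) §B2∕§E3): **`integral_conj_eq_sum_ncard_shell_smul_onePlace`** —
  `∫_{H_v} f(y x y⁻¹) dν(y) = Σ_{i ∈ s} #{M ∈ SV | d M = i} • ∫_{K × U(Φ₁)_v} f(k⁻¹ ((E₂⁻¹ r_i, 1)⁻¹ x (E₂⁻¹ r_i, 1)) k) dν(k)` under the rank-one letter's
  `[ν.IsHaarMeasure] [ν.IsMulRightInvariant]`, a finite vertex set `SV` carrying the support, and a `U_w`-level shell hypothesis `hshellU` (= B-p08 (g28) ★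
  `exists_comm_rhoVertexActPlace_mul_eq` over (W′1) ★ `exists_torus_shell_eq`, reps `rU m = uη⁻¹ ^ m` by ★ `rhoVertexActPlace_inv_pow_root_eq`);
  (ED. 3) `integral_conj_sub_integral_conj_eq_sum_ncard_shell_smul_sub_onePlace` — the DIFFERENCE form at `(x, x′) = (↑t, e ↑t)`, the LHS of the (γ) layer's `hO`.

References: [Rogawski1990] §4.9 p. 54 · [LabesseLanglands1979] §2 p. 8 · [Kottwitz1986] §3 · [Serre1980Trees] Ch. II §1.2–1.4.
-/

set_option autoImplicit false

noncomputable section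

open MeasureTheory Topology Set Function MulAction NumberField IsDedekindDomain
open scoped MatrixGroups Matrix ValuativeRel

namespace Literature.NumberTheory.Rogawski1990

open Literature.NumberTheory.Automorphic Literature.NumberTheory.Automorphic.UnitaryGroup Literature.NumberTheory.GaloisRepresentations
  Literature.NumberTheory.Automorphic.HermitianLatticeTree

variable (L : Type) [Field L] [NumberField L] [IsCMField L] (v : HeightOneSpectrum (𝓞 ↥(maximalRealSubfield L)))
  (w : PlacesOver L v) (hw : IsCMField.complexConj L • w.1 = w.1)
  {α : w.1.adicCompletion L} (hα : galAdicCompletionMap (L := L) (IsCMField.complexConj L) hw α = -α) (hα0 : α ≠ 0)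
  {ϖF : v.adicCompletion ↥(maximalRealSubfield L)} (hϖF : Valued.v ϖF = WithZero.exp (-1 : ℤ))
  (he : v.asIdeal.ramificationIdx' w.1.asIdeal ≠ 1)

include he in
/-- **ONE VERTEX ORBIT through the one-place model**: at a ramified `w`, for every vertex `N` there is `g ∈ U(Φ₂)(L⁺_v)` with `ρ_w(E₂ g)·x₀ = N` (★ `exists_rhoVertexActPlace_eq`
pulled back along the surjection `E₂`). [cite: Serre1980Trees, Ch. II §1.2–1.4] -/
theorem exists_rhoVertexActPlace_onePlace_eq
    (E₂ : (cmDatum L 2 (Matrix.of fun i j : Fin 2 => if i.val + j.val + 1 = 2 then (1 : L) else 0)).Local v ≃ₜ*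
      ↥(unitaryGroupOfForm (galAdicCompletionMap (L := L) (IsCMField.complexConj L) hw)
        (placeForm (Matrix.of fun i j : Fin 2 => if i.val + j.val + 1 = 2 then (1 : L) else 0) w.1)))
    (x₀ : {M : Submodule 𝒪[v.adicCompletion ↥(maximalRealSubfield L)] (Fin 2 → v.adicCompletion ↥(maximalRealSubfield L)) //
      IsSpecialLattice (RingHom.id _) ϖF !![(0 : v.adicCompletion ↥(maximalRealSubfield L)), 1; -1, 0] M})
    (hx₀ : x₀.1 = latt (1 : Matrix (Fin 2) (Fin 2) (v.adicCompletion ↥(maximalRealSubfield L))))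
    (N : {M : Submodule 𝒪[v.adicCompletion ↥(maximalRealSubfield L)] (Fin 2 → v.adicCompletion ↥(maximalRealSubfield L)) //
      IsSpecialLattice (RingHom.id _) ϖF !![(0 : v.adicCompletion ↥(maximalRealSubfield L)), 1; -1, 0] M}) :
    ∃ g : (cmDatum L 2 (Matrix.of fun i j : Fin 2 => if i.val + j.val + 1 = 2 then (1 : L) else 0)).Local v,
      rhoVertexActPlace L v w hw hα hα0 hϖF (E₂ g) x₀ = N := by
  obtain ⟨u, hu⟩ := exists_rhoVertexActPlace_eq L v w hw hα hα0 hϖF he x₀ hx₀ N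
  exact ⟨E₂.symm u, by rw [ContinuousMulEquiv.apply_symm_apply]; exact hu⟩

include he in
/-- **The `hfin` currency of ★ I-7 read on the tree**: finitely many `x`-fixed cosets in `H_v ⧸ (K × U(Φ₁)_v)` iff finitely many `ρ_w(E₂ x.1)`-fixed vertices
(so ★ `finite_fixedBy_quotient_of_isCompact_setOf_conj_mem` on the elliptic torus gives the vertex finiteness, and (W′1)'s «`Fix` is a ball» gives the coset one).
[cite: Kottwitz1986, §3] [cite: Serre1980Trees, Ch. II §1.2–1.4] -/
theorem finite_fixedBy_quotient_prod_iff_fixedVertices_onePlace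
    (K : Subgroup ((cmDatum L 2 (Matrix.of fun i j : Fin 2 => if i.val + j.val + 1 = 2 then (1 : L) else 0)).Local v))
    (E₂ : (cmDatum L 2 (Matrix.of fun i j : Fin 2 => if i.val + j.val + 1 = 2 then (1 : L) else 0)).Local v ≃ₜ*
      ↥(unitaryGroupOfForm (galAdicCompletionMap (L := L) (IsCMField.complexConj L) hw)
        (placeForm (Matrix.of fun i j : Fin 2 => if i.val + j.val + 1 = 2 then (1 : L) else 0) w.1)))
    (x₀ : {M : Submodule 𝒪[v.adicCompletion ↥(maximalRealSubfield L)] (Fin 2 → v.adicCompletion ↥(maximalRealSubfield L)) //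
      IsSpecialLattice (RingHom.id _) ϖF !![(0 : v.adicCompletion ↥(maximalRealSubfield L)), 1; -1, 0] M})
    (hx₀ : x₀.1 = latt (1 : Matrix (Fin 2) (Fin 2) (v.adicCompletion ↥(maximalRealSubfield L))))
    (hK : ∀ g, g ∈ K ↔ rhoVertexActPlace L v w hw hα hα0 hϖF (E₂ g) x₀ = x₀)
    (x : ((cmDatum L 2 (Matrix.of fun i j : Fin 2 => if i.val + j.val + 1 = 2 then (1 : L) else 0)).Local v ×
      (cmDatum L 1 (Matrix.of fun i j : Fin 1 => if i.val + j.val + 1 = 1 then (1 : L) else 0)).Local v)) :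
    (fixedBy ((((cmDatum L 2 (Matrix.of fun i j : Fin 2 => if i.val + j.val + 1 = 2 then (1 : L) else 0)).Local v ×
        (cmDatum L 1 (Matrix.of fun i j : Fin 1 => if i.val + j.val + 1 = 1 then (1 : L) else 0)).Local v)) ⧸
          K.prod (⊤ : Subgroup ((cmDatum L 1 (Matrix.of fun i j : Fin 1 => if i.val + j.val + 1 = 1 then (1 : L) else 0)).Local v))) x).Finite ↔
      {M : {M : Submodule 𝒪[v.adicCompletion ↥(maximalRealSubfield L)] (Fin 2 → v.adicCompletion ↥(maximalRealSubfield L)) //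
          IsSpecialLattice (RingHom.id _) ϖF !![(0 : v.adicCompletion ↥(maximalRealSubfield L)), 1; -1, 0] M} |
          rhoVertexActPlace L v w hw hα hα0 hϖF (E₂ x.1) M = M}.Finite := by
  obtain ⟨γ, a⟩ := x
  exact finite_fixedBy_quotient_prod_iff_of_vertexAction (rhoVertexActPlace L v w hw hα hα0 hϖF)
    (rhoVertexActPlace_one L v w hw hα hα0 hϖF) (rhoVertexActPlace_mul L v w hw hα hα0 hϖF) E₂.toMulEquiv.toMonoidHom
    (exists_rhoVertexActPlace_onePlace_eq L v w hw hα hα0 hϖF he E₂ x₀ hx₀) K hK γ a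


variable
  [MeasurableSpace (((cmDatum L 2 (Matrix.of fun i j : Fin 2 => if i.val + j.val + 1 = 2 then (1 : L) else 0)).Local v ×
    (cmDatum L 1 (Matrix.of fun i j : Fin 1 => if i.val + j.val + 1 = 1 then (1 : L) else 0)).Local v))]
  [BorelSpace (((cmDatum L 2 (Matrix.of fun i j : Fin 2 => if i.val + j.val + 1 = 2 then (1 : L) else 0)).Local v ×
    (cmDatum L 1 (Matrix.of fun i j : Fin 1 => if i.val + j.val + 1 = 1 then (1 : L) else 0)).Local v))]
  (ν : Measure (((cmDatum L 2 (Matrix.of fun i j : Fin 2 => if i.val + j.val + 1 = 2 then (1 : L) else 0)).Local v ×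
    (cmDatum L 1 (Matrix.of fun i j : Fin 1 => if i.val + j.val + 1 = 1 then (1 : L) else 0)).Local v)))
  [ν.IsMulRightInvariant]
  {E : Type*} [NormedAddCommGroup E] [NormedSpace ℝ E] [CompleteSpace E]

include he in
/-- **THE `H_v → TREE` UNFOLDING (value-law form).**  `K ≤ U(Φ₂)(L⁺_v)` the stabiliser of the root `x₀` through `ρ_w ∘ E₂` (`g ∈ K ↔ ρ_w(E₂ g)·x₀ = x₀`), `K × U(Φ₁)_v`
open of finite mass, `φ : H_v → E` supported in `K × U(Φ₁)_v` and `Ad(K × U(Φ₁)_v)`-invariant, `x ∈ H_v` with finitely many `ρ_w(E₂ x.1)`-fixed vertices, and a value law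
`φ (g⁻¹ x.1 g, x.2) = val (ρ_w(E₂ g)·x₀)` at them:
`∫ φ(y x y⁻¹) dν(y) = ν(K × U(Φ₁)_v) · Σᶠ_{M ∈ V(X), ρ_w(E₂ x.1)·M = M} val M` — the vertex twin of ★ I-7 `integral_conj_eq_smul_finsum_onePlace`.
[cite: Rogawski1990, §4.9 p. 54] [cite: Kottwitz1986, §3] [cite: LabesseLanglands1979, §2 p. 8] -/
theorem integral_conj_eq_smul_finsum_fixedVertices_onePlace
    (K : Subgroup ((cmDatum L 2 (Matrix.of fun i j : Fin 2 => if i.val + j.val + 1 = 2 then (1 : L) else 0)).Local v))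
    (E₂ : (cmDatum L 2 (Matrix.of fun i j : Fin 2 => if i.val + j.val + 1 = 2 then (1 : L) else 0)).Local v ≃ₜ*
      ↥(unitaryGroupOfForm (galAdicCompletionMap (L := L) (IsCMField.complexConj L) hw)
        (placeForm (Matrix.of fun i j : Fin 2 => if i.val + j.val + 1 = 2 then (1 : L) else 0) w.1)))
    (x₀ : {M : Submodule 𝒪[v.adicCompletion ↥(maximalRealSubfield L)] (Fin 2 → v.adicCompletion ↥(maximalRealSubfield L)) //
      IsSpecialLattice (RingHom.id _) ϖF !![(0 : v.adicCompletion ↥(maximalRealSubfield L)), 1; -1, 0] M})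
    (hx₀ : x₀.1 = latt (1 : Matrix (Fin 2) (Fin 2) (v.adicCompletion ↥(maximalRealSubfield L))))
    (hK : ∀ g, g ∈ K ↔ rhoVertexActPlace L v w hw hα hα0 hϖF (E₂ g) x₀ = x₀)
    (hKo : IsOpen ((K.prod (⊤ : Subgroup ((cmDatum L 1 (Matrix.of fun i j : Fin 1 => if i.val + j.val + 1 = 1 then (1 : L) else 0)).Local v)) :
      Subgroup (((cmDatum L 2 (Matrix.of fun i j : Fin 2 => if i.val + j.val + 1 = 2 then (1 : L) else 0)).Local v ×
        (cmDatum L 1 (Matrix.of fun i j : Fin 1 => if i.val + j.val + 1 = 1 then (1 : L) else 0)).Local v))) : Set (((cmDatum L 2 (Matrix.of fun i j : Fin 2 => if i.val + j.val + 1 = 2 then (1 : L) else 0)).Local v ×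
        (cmDatum L 1 (Matrix.of fun i j : Fin 1 => if i.val + j.val + 1 = 1 then (1 : L) else 0)).Local v))))
    (hKν : ν ((K.prod (⊤ : Subgroup ((cmDatum L 1 (Matrix.of fun i j : Fin 1 => if i.val + j.val + 1 = 1 then (1 : L) else 0)).Local v)) :
      Subgroup (((cmDatum L 2 (Matrix.of fun i j : Fin 2 => if i.val + j.val + 1 = 2 then (1 : L) else 0)).Local v ×
        (cmDatum L 1 (Matrix.of fun i j : Fin 1 => if i.val + j.val + 1 = 1 then (1 : L) else 0)).Local v))) : Set (((cmDatum L 2 (Matrix.of fun i j : Fin 2 => if i.val + j.val + 1 = 2 then (1 : L) else 0)).Local v ×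
        (cmDatum L 1 (Matrix.of fun i j : Fin 1 => if i.val + j.val + 1 = 1 then (1 : L) else 0)).Local v))) ≠ ⊤)
    (x : ((cmDatum L 2 (Matrix.of fun i j : Fin 2 => if i.val + j.val + 1 = 2 then (1 : L) else 0)).Local v ×
      (cmDatum L 1 (Matrix.of fun i j : Fin 1 => if i.val + j.val + 1 = 1 then (1 : L) else 0)).Local v))
    (φ : (((cmDatum L 2 (Matrix.of fun i j : Fin 2 => if i.val + j.val + 1 = 2 then (1 : L) else 0)).Local v ×
      (cmDatum L 1 (Matrix.of fun i j : Fin 1 => if i.val + j.val + 1 = 1 then (1 : L) else 0)).Local v)) → E)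
    (hφ : support φ ⊆ ((K.prod (⊤ : Subgroup ((cmDatum L 1 (Matrix.of fun i j : Fin 1 => if i.val + j.val + 1 = 1 then (1 : L) else 0)).Local v)) :
      Subgroup (((cmDatum L 2 (Matrix.of fun i j : Fin 2 => if i.val + j.val + 1 = 2 then (1 : L) else 0)).Local v ×
        (cmDatum L 1 (Matrix.of fun i j : Fin 1 => if i.val + j.val + 1 = 1 then (1 : L) else 0)).Local v))) : Set (((cmDatum L 2 (Matrix.of fun i j : Fin 2 => if i.val + j.val + 1 = 2 then (1 : L) else 0)).Local v ×
        (cmDatum L 1 (Matrix.of fun i j : Fin 1 => if i.val + j.val + 1 = 1 then (1 : L) else 0)).Local v))))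
    (hφK : ∀ k ∈ K.prod (⊤ : Subgroup ((cmDatum L 1 (Matrix.of fun i j : Fin 1 => if i.val + j.val + 1 = 1 then (1 : L) else 0)).Local v)),
      ∀ y, φ (k * y * k⁻¹) = φ y)
    (hfin : {M : {M : Submodule 𝒪[v.adicCompletion ↥(maximalRealSubfield L)] (Fin 2 → v.adicCompletion ↥(maximalRealSubfield L)) //
        IsSpecialLattice (RingHom.id _) ϖF !![(0 : v.adicCompletion ↥(maximalRealSubfield L)), 1; -1, 0] M} |
        rhoVertexActPlace L v w hw hα hα0 hϖF (E₂ x.1) M = M}.Finite)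
    (val : {M : Submodule 𝒪[v.adicCompletion ↥(maximalRealSubfield L)] (Fin 2 → v.adicCompletion ↥(maximalRealSubfield L)) //
        IsSpecialLattice (RingHom.id _) ϖF !![(0 : v.adicCompletion ↥(maximalRealSubfield L)), 1; -1, 0] M} → E)
    (hval : ∀ g : (cmDatum L 2 (Matrix.of fun i j : Fin 2 => if i.val + j.val + 1 = 2 then (1 : L) else 0)).Local v,
      rhoVertexActPlace L v w hw hα hα0 hϖF (E₂ x.1) (rhoVertexActPlace L v w hw hα hα0 hϖF (E₂ g) x₀) = rhoVertexActPlace L v w hw hα hα0 hϖF (E₂ g) x₀ →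
        φ (g⁻¹ * x.1 * g, x.2) = val (rhoVertexActPlace L v w hw hα hα0 hϖF (E₂ g) x₀)) :
    ∫ y, φ (y * x * y⁻¹) ∂ν =
      ν.real ((K.prod (⊤ : Subgroup ((cmDatum L 1 (Matrix.of fun i j : Fin 1 => if i.val + j.val + 1 = 1 then (1 : L) else 0)).Local v)) :
        Subgroup (((cmDatum L 2 (Matrix.of fun i j : Fin 2 => if i.val + j.val + 1 = 2 then (1 : L) else 0)).Local v ×
          (cmDatum L 1 (Matrix.of fun i j : Fin 1 => if i.val + j.val + 1 = 1 then (1 : L) else 0)).Local v))) : Set (((cmDatum L 2 (Matrix.of fun i j : Fin 2 => if i.val + j.val + 1 = 2 then (1 : L) else 0)).Local v ×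
        (cmDatum L 1 (Matrix.of fun i j : Fin 1 => if i.val + j.val + 1 = 1 then (1 : L) else 0)).Local v))) •
        ∑ᶠ M ∈ {M : {M : Submodule 𝒪[v.adicCompletion ↥(maximalRealSubfield L)] (Fin 2 → v.adicCompletion ↥(maximalRealSubfield L)) //
            IsSpecialLattice (RingHom.id _) ϖF !![(0 : v.adicCompletion ↥(maximalRealSubfield L)), 1; -1, 0] M} |
            rhoVertexActPlace L v w hw hα hα0 hϖF (E₂ x.1) M = M}, val M :=
  integral_conj_eq_smul_finsum_fixedPoints_of_vertexAction_prod ν (rhoVertexActPlace L v w hw hα hα0 hϖF)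
    (rhoVertexActPlace_one L v w hw hα hα0 hϖF) (rhoVertexActPlace_mul L v w hw hα hα0 hϖF) E₂.toMulEquiv.toMonoidHom
    (exists_rhoVertexActPlace_onePlace_eq L v w hw hα hα0 hϖF he E₂ x₀ hx₀) K hK hKo hKν x φ hφ hφK hfin val hval

include he in
/-- **THE `H_v → TREE` UNFOLDING, SHELL FORM** (Labesse–Langlands' `Σ_m C_m(γ) · f(α_m⁻¹ γ α_m)`): with a shell index `d` on the vertices, representatives
`r : ℕ → U(Φ₂)(L⁺_v)` and the SHELL HYPOTHESIS «every `ρ_w(E₂ x.1)`-fixed vertex `M` is `ρ_w(E₂ (t · r (d M)))·x₀` for some `t` commuting with `x.1`» ((W′1)), finitely many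
fixed vertices all of shell index `≤ N`:
`∫ φ(y x y⁻¹) dν(y) = ν(K × U(Φ₁)_v) · Σ_{m ≤ N} #{M fixed | d M = m} • φ (r_m⁻¹ x.1 r_m, x.2)`. [cite: LabesseLanglands1979, §2 p. 8] [cite: Rogawski1990, §4.9 p. 54]
[cite: Kottwitz1986, §3] -/
theorem integral_conj_eq_smul_sum_shells_onePlace
    (K : Subgroup ((cmDatum L 2 (Matrix.of fun i j : Fin 2 => if i.val + j.val + 1 = 2 then (1 : L) else 0)).Local v))
    (E₂ : (cmDatum L 2 (Matrix.of fun i j : Fin 2 => if i.val + j.val + 1 = 2 then (1 : L) else 0)).Local v ≃ₜ*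
      ↥(unitaryGroupOfForm (galAdicCompletionMap (L := L) (IsCMField.complexConj L) hw)
        (placeForm (Matrix.of fun i j : Fin 2 => if i.val + j.val + 1 = 2 then (1 : L) else 0) w.1)))
    (x₀ : {M : Submodule 𝒪[v.adicCompletion ↥(maximalRealSubfield L)] (Fin 2 → v.adicCompletion ↥(maximalRealSubfield L)) //
      IsSpecialLattice (RingHom.id _) ϖF !![(0 : v.adicCompletion ↥(maximalRealSubfield L)), 1; -1, 0] M})
    (hx₀ : x₀.1 = latt (1 : Matrix (Fin 2) (Fin 2) (v.adicCompletion ↥(maximalRealSubfield L))))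
    (hK : ∀ g, g ∈ K ↔ rhoVertexActPlace L v w hw hα hα0 hϖF (E₂ g) x₀ = x₀)
    (hKo : IsOpen ((K.prod (⊤ : Subgroup ((cmDatum L 1 (Matrix.of fun i j : Fin 1 => if i.val + j.val + 1 = 1 then (1 : L) else 0)).Local v)) :
      Subgroup (((cmDatum L 2 (Matrix.of fun i j : Fin 2 => if i.val + j.val + 1 = 2 then (1 : L) else 0)).Local v ×
        (cmDatum L 1 (Matrix.of fun i j : Fin 1 => if i.val + j.val + 1 = 1 then (1 : L) else 0)).Local v))) : Set (((cmDatum L 2 (Matrix.of fun i j : Fin 2 => if i.val + j.val + 1 = 2 then (1 : L) else 0)).Local v ×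
        (cmDatum L 1 (Matrix.of fun i j : Fin 1 => if i.val + j.val + 1 = 1 then (1 : L) else 0)).Local v))))
    (hKν : ν ((K.prod (⊤ : Subgroup ((cmDatum L 1 (Matrix.of fun i j : Fin 1 => if i.val + j.val + 1 = 1 then (1 : L) else 0)).Local v)) :
      Subgroup (((cmDatum L 2 (Matrix.of fun i j : Fin 2 => if i.val + j.val + 1 = 2 then (1 : L) else 0)).Local v ×
        (cmDatum L 1 (Matrix.of fun i j : Fin 1 => if i.val + j.val + 1 = 1 then (1 : L) else 0)).Local v))) : Set (((cmDatum L 2 (Matrix.of fun i j : Fin 2 => if i.val + j.val + 1 = 2 then (1 : L) else 0)).Local v ×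
        (cmDatum L 1 (Matrix.of fun i j : Fin 1 => if i.val + j.val + 1 = 1 then (1 : L) else 0)).Local v))) ≠ ⊤)
    (x : ((cmDatum L 2 (Matrix.of fun i j : Fin 2 => if i.val + j.val + 1 = 2 then (1 : L) else 0)).Local v ×
      (cmDatum L 1 (Matrix.of fun i j : Fin 1 => if i.val + j.val + 1 = 1 then (1 : L) else 0)).Local v))
    (φ : (((cmDatum L 2 (Matrix.of fun i j : Fin 2 => if i.val + j.val + 1 = 2 then (1 : L) else 0)).Local v ×
      (cmDatum L 1 (Matrix.of fun i j : Fin 1 => if i.val + j.val + 1 = 1 then (1 : L) else 0)).Local v)) → E)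
    (hφ : support φ ⊆ ((K.prod (⊤ : Subgroup ((cmDatum L 1 (Matrix.of fun i j : Fin 1 => if i.val + j.val + 1 = 1 then (1 : L) else 0)).Local v)) :
      Subgroup (((cmDatum L 2 (Matrix.of fun i j : Fin 2 => if i.val + j.val + 1 = 2 then (1 : L) else 0)).Local v ×
        (cmDatum L 1 (Matrix.of fun i j : Fin 1 => if i.val + j.val + 1 = 1 then (1 : L) else 0)).Local v))) : Set (((cmDatum L 2 (Matrix.of fun i j : Fin 2 => if i.val + j.val + 1 = 2 then (1 : L) else 0)).Local v ×
        (cmDatum L 1 (Matrix.of fun i j : Fin 1 => if i.val + j.val + 1 = 1 then (1 : L) else 0)).Local v))))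
    (hφK : ∀ k ∈ K.prod (⊤ : Subgroup ((cmDatum L 1 (Matrix.of fun i j : Fin 1 => if i.val + j.val + 1 = 1 then (1 : L) else 0)).Local v)),
      ∀ y, φ (k * y * k⁻¹) = φ y)
    (hfin : {M : {M : Submodule 𝒪[v.adicCompletion ↥(maximalRealSubfield L)] (Fin 2 → v.adicCompletion ↥(maximalRealSubfield L)) //
        IsSpecialLattice (RingHom.id _) ϖF !![(0 : v.adicCompletion ↥(maximalRealSubfield L)), 1; -1, 0] M} |
        rhoVertexActPlace L v w hw hα hα0 hϖF (E₂ x.1) M = M}.Finite)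
    (d : {M : Submodule 𝒪[v.adicCompletion ↥(maximalRealSubfield L)] (Fin 2 → v.adicCompletion ↥(maximalRealSubfield L)) //
        IsSpecialLattice (RingHom.id _) ϖF !![(0 : v.adicCompletion ↥(maximalRealSubfield L)), 1; -1, 0] M} → ℕ)
    (r : ℕ → (cmDatum L 2 (Matrix.of fun i j : Fin 2 => if i.val + j.val + 1 = 2 then (1 : L) else 0)).Local v) (N : ℕ)
    (hshell : ∀ M : {M : Submodule 𝒪[v.adicCompletion ↥(maximalRealSubfield L)] (Fin 2 → v.adicCompletion ↥(maximalRealSubfield L)) //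
        IsSpecialLattice (RingHom.id _) ϖF !![(0 : v.adicCompletion ↥(maximalRealSubfield L)), 1; -1, 0] M},
      rhoVertexActPlace L v w hw hα hα0 hϖF (E₂ x.1) M = M →
        ∃ t : (cmDatum L 2 (Matrix.of fun i j : Fin 2 => if i.val + j.val + 1 = 2 then (1 : L) else 0)).Local v,
          t * x.1 = x.1 * t ∧ rhoVertexActPlace L v w hw hα hα0 hϖF (E₂ (t * r (d M))) x₀ = M)
    (hN : ∀ M : {M : Submodule 𝒪[v.adicCompletion ↥(maximalRealSubfield L)] (Fin 2 → v.adicCompletion ↥(maximalRealSubfield L)) //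
        IsSpecialLattice (RingHom.id _) ϖF !![(0 : v.adicCompletion ↥(maximalRealSubfield L)), 1; -1, 0] M},
      rhoVertexActPlace L v w hw hα hα0 hϖF (E₂ x.1) M = M → d M ≤ N) :
    ∫ y, φ (y * x * y⁻¹) ∂ν =
      ν.real ((K.prod (⊤ : Subgroup ((cmDatum L 1 (Matrix.of fun i j : Fin 1 => if i.val + j.val + 1 = 1 then (1 : L) else 0)).Local v)) :
        Subgroup (((cmDatum L 2 (Matrix.of fun i j : Fin 2 => if i.val + j.val + 1 = 2 then (1 : L) else 0)).Local v ×
          (cmDatum L 1 (Matrix.of fun i j : Fin 1 => if i.val + j.val + 1 = 1 then (1 : L) else 0)).Local v))) : Set (((cmDatum L 2 (Matrix.of fun i j : Fin 2 => if i.val + j.val + 1 = 2 then (1 : L) else 0)).Local v ×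
        (cmDatum L 1 (Matrix.of fun i j : Fin 1 => if i.val + j.val + 1 = 1 then (1 : L) else 0)).Local v))) •
        ∑ m ∈ Finset.range (N + 1),
          {M : {M : Submodule 𝒪[v.adicCompletion ↥(maximalRealSubfield L)] (Fin 2 → v.adicCompletion ↥(maximalRealSubfield L)) //
              IsSpecialLattice (RingHom.id _) ϖF !![(0 : v.adicCompletion ↥(maximalRealSubfield L)), 1; -1, 0] M} |
              rhoVertexActPlace L v w hw hα hα0 hϖF (E₂ x.1) M = M ∧ d M = m}.ncard • φ ((r m)⁻¹ * x.1 * r m, x.2) :=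
  integral_conj_eq_smul_sum_shells_of_vertexAction_prod ν (rhoVertexActPlace L v w hw hα hα0 hϖF)
    (rhoVertexActPlace_one L v w hw hα hα0 hϖF) (rhoVertexActPlace_mul L v w hw hα hα0 hϖF) E₂.toMulEquiv.toMonoidHom
    (exists_rhoVertexActPlace_onePlace_eq L v w hw hα hα0 hϖF he E₂ x₀ hx₀) K hK hKo hKν x φ hφ hφK hfin d r N hshell hN


/-! ## §2 (ED. 2) The general-`f` shell sum on `H_v` (socket (Ψ1); no support condition, no pieces) -/

section GeneralTestFunction

variable
  [SecondCountableTopology (((cmDatum L 2 (Matrix.of fun i j : Fin 2 => if i.val + j.val + 1 = 2 then (1 : L) else 0)).Local v ×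
    (cmDatum L 1 (Matrix.of fun i j : Fin 1 => if i.val + j.val + 1 = 1 then (1 : L) else 0)).Local v))]
  [LocallyCompactSpace (((cmDatum L 2 (Matrix.of fun i j : Fin 2 => if i.val + j.val + 1 = 2 then (1 : L) else 0)).Local v ×
    (cmDatum L 1 (Matrix.of fun i j : Fin 1 => if i.val + j.val + 1 = 1 then (1 : L) else 0)).Local v))]
  [ν.IsHaarMeasure]

omit [CompleteSpace E] in
include he in
/-- **(Ψ1) THE ORBITAL INTEGRAL OF A GENERAL TEST FUNCTION ON `H_v` AS A `T̃`-SHELL SUM ON THE TREE** (Labesse–Langlands' `∫_{T̃∖G̃} f(x̃⁻¹ t x̃) dx̃ =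
Σ_m C_m ∫_{K̃} f(k⁻¹ α_m⁻¹ t α_m k) dk`; (W′0) §B2).  `K ≤ U(Φ₂)(L⁺_v)` the stabiliser of the root through `ρ_w ∘ E₂`, `K × U(Φ₁)_v` open; `ν` a Haar measure that is also
right-invariant (the rank-one letter's instances; inversion invariance by ★ `isInvInvariant_of_isHaarMeasure_of_isMulRightInvariant`); `f : H_v → E` ANY function with
`y ↦ f(y⁻¹ x y)` integrable and vanishing unless the vertex `ρ_w(E₂ y.1)·x₀` lies in the finite set `SV`; a shell index `d : V(X) → ι`, representatives `rU : ι → ↥U_w`, a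
window `s`, and the `U_w`-LEVEL SHELL HYPOTHESIS «every `M ∈ SV` is `ρ_w(tU · rU (d M))·x₀` with `tU` commuting with `E₂ x.1`» (★ B-p08 `exists_comm_rhoVertexActPlace_mul_eq`
over (W′1) ★ `exists_torus_shell_eq`).  Then
`∫_{H_v} f(y x y⁻¹) dν(y) = Σ_{i ∈ s} #{M ∈ SV | d M = i} • ∫_{K × U(Φ₁)_v} f(k⁻¹ · ((E₂⁻¹ (rU i), 1)⁻¹ x (E₂⁻¹ (rU i), 1)) · k) dν(k)`.
[cite: LabesseLanglands1979, §2 p. 8] [cite: Rogawski1990, §4.9 p. 54] [cite: Kottwitz1986, §3] -/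
theorem integral_conj_eq_sum_ncard_shell_smul_onePlace
    (K : Subgroup ((cmDatum L 2 (Matrix.of fun i j : Fin 2 => if i.val + j.val + 1 = 2 then (1 : L) else 0)).Local v))
    (E₂ : (cmDatum L 2 (Matrix.of fun i j : Fin 2 => if i.val + j.val + 1 = 2 then (1 : L) else 0)).Local v ≃ₜ*
      ↥(unitaryGroupOfForm (galAdicCompletionMap (L := L) (IsCMField.complexConj L) hw)
        (placeForm (Matrix.of fun i j : Fin 2 => if i.val + j.val + 1 = 2 then (1 : L) else 0) w.1)))
    (x₀ : {M : Submodule 𝒪[v.adicCompletion ↥(maximalRealSubfield L)] (Fin 2 → v.adicCompletion ↥(maximalRealSubfield L)) //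
      IsSpecialLattice (RingHom.id _) ϖF !![(0 : v.adicCompletion ↥(maximalRealSubfield L)), 1; -1, 0] M})
    (hx₀ : x₀.1 = latt (1 : Matrix (Fin 2) (Fin 2) (v.adicCompletion ↥(maximalRealSubfield L))))
    (hK : ∀ g, g ∈ K ↔ rhoVertexActPlace L v w hw hα hα0 hϖF (E₂ g) x₀ = x₀)
    (hKo : IsOpen ((K.prod (⊤ : Subgroup ((cmDatum L 1 (Matrix.of fun i j : Fin 1 => if i.val + j.val + 1 = 1 then (1 : L) else 0)).Local v)) :
      Subgroup (((cmDatum L 2 (Matrix.of fun i j : Fin 2 => if i.val + j.val + 1 = 2 then (1 : L) else 0)).Local v ×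
        (cmDatum L 1 (Matrix.of fun i j : Fin 1 => if i.val + j.val + 1 = 1 then (1 : L) else 0)).Local v))) :
          Set (((cmDatum L 2 (Matrix.of fun i j : Fin 2 => if i.val + j.val + 1 = 2 then (1 : L) else 0)).Local v ×
        (cmDatum L 1 (Matrix.of fun i j : Fin 1 => if i.val + j.val + 1 = 1 then (1 : L) else 0)).Local v))))
    (x : ((cmDatum L 2 (Matrix.of fun i j : Fin 2 => if i.val + j.val + 1 = 2 then (1 : L) else 0)).Local v ×
      (cmDatum L 1 (Matrix.of fun i j : Fin 1 => if i.val + j.val + 1 = 1 then (1 : L) else 0)).Local v))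
    (f : (((cmDatum L 2 (Matrix.of fun i j : Fin 2 => if i.val + j.val + 1 = 2 then (1 : L) else 0)).Local v ×
      (cmDatum L 1 (Matrix.of fun i j : Fin 1 => if i.val + j.val + 1 = 1 then (1 : L) else 0)).Local v)) → E)
    (hF : Integrable (fun y : ((cmDatum L 2 (Matrix.of fun i j : Fin 2 => if i.val + j.val + 1 = 2 then (1 : L) else 0)).Local v ×
      (cmDatum L 1 (Matrix.of fun i j : Fin 1 => if i.val + j.val + 1 = 1 then (1 : L) else 0)).Local v) => f (y⁻¹ * x * y)) ν)
    {SV : Set {M : Submodule 𝒪[v.adicCompletion ↥(maximalRealSubfield L)] (Fin 2 → v.adicCompletion ↥(maximalRealSubfield L)) //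
      IsSpecialLattice (RingHom.id _) ϖF !![(0 : v.adicCompletion ↥(maximalRealSubfield L)), 1; -1, 0] M}} (hSV : SV.Finite)
    (hsupp : ∀ y : ((cmDatum L 2 (Matrix.of fun i j : Fin 2 => if i.val + j.val + 1 = 2 then (1 : L) else 0)).Local v ×
      (cmDatum L 1 (Matrix.of fun i j : Fin 1 => if i.val + j.val + 1 = 1 then (1 : L) else 0)).Local v),
      f (y⁻¹ * x * y) ≠ 0 → rhoVertexActPlace L v w hw hα hα0 hϖF (E₂ y.1) x₀ ∈ SV)
    {ι : Type*} (d : {M : Submodule 𝒪[v.adicCompletion ↥(maximalRealSubfield L)] (Fin 2 → v.adicCompletion ↥(maximalRealSubfield L)) //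
      IsSpecialLattice (RingHom.id _) ϖF !![(0 : v.adicCompletion ↥(maximalRealSubfield L)), 1; -1, 0] M} → ι)
    (rU : ι → ↥(unitaryGroupOfForm (galAdicCompletionMap (L := L) (IsCMField.complexConj L) hw)
      (placeForm (Matrix.of fun i j : Fin 2 => if i.val + j.val + 1 = 2 then (1 : L) else 0) w.1)))
    (s : Finset ι)
    (hshellU : ∀ M ∈ SV, ∃ tU : ↥(unitaryGroupOfForm (galAdicCompletionMap (L := L) (IsCMField.complexConj L) hw)
        (placeForm (Matrix.of fun i j : Fin 2 => if i.val + j.val + 1 = 2 then (1 : L) else 0) w.1)),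
      tU * E₂ x.1 = E₂ x.1 * tU ∧ rhoVertexActPlace L v w hw hα hα0 hϖF (tU * rU (d M)) x₀ = M)
    (hs : ∀ M ∈ SV, d M ∈ s) :
    ∫ y, f (y * x * y⁻¹) ∂ν =
      ∑ i ∈ s, {M ∈ SV | d M = i}.ncard •
        ∫ k in ((K.prod (⊤ : Subgroup ((cmDatum L 1 (Matrix.of fun i j : Fin 1 => if i.val + j.val + 1 = 1 then (1 : L) else 0)).Local v)) :
            Subgroup (((cmDatum L 2 (Matrix.of fun i j : Fin 2 => if i.val + j.val + 1 = 2 then (1 : L) else 0)).Local v ×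
              (cmDatum L 1 (Matrix.of fun i j : Fin 1 => if i.val + j.val + 1 = 1 then (1 : L) else 0)).Local v))) :
            Set (((cmDatum L 2 (Matrix.of fun i j : Fin 2 => if i.val + j.val + 1 = 2 then (1 : L) else 0)).Local v ×
              (cmDatum L 1 (Matrix.of fun i j : Fin 1 => if i.val + j.val + 1 = 1 then (1 : L) else 0)).Local v))),
          f (k⁻¹ * (((E₂.symm (rU i), (1 : (cmDatum L 1 (Matrix.of fun i j : Fin 1 => if i.val + j.val + 1 = 1 then (1 : L) else 0)).Local v)) :
              ((cmDatum L 2 (Matrix.of fun i j : Fin 2 => if i.val + j.val + 1 = 2 then (1 : L) else 0)).Local v ×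
                (cmDatum L 1 (Matrix.of fun i j : Fin 1 => if i.val + j.val + 1 = 1 then (1 : L) else 0)).Local v))⁻¹ * x *
            (E₂.symm (rU i), 1)) * k) ∂ν := by
  -- the composite action of `H_v` on the vertices through the first factor and `E₂`
  refine integral_conj_eq_sum_ncard_shell_smul_of_vertexAction_haar ν (K.prod ⊤)
    (fun h : ((cmDatum L 2 (Matrix.of fun i j : Fin 2 => if i.val + j.val + 1 = 2 then (1 : L) else 0)).Local v ×
      (cmDatum L 1 (Matrix.of fun i j : Fin 1 => if i.val + j.val + 1 = 1 then (1 : L) else 0)).Local v) => rhoVertexActPlace L v w hw hα hα0 hϖF (E₂ h.1))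
    (fun M => by simp only [Prod.fst_one, map_one, rhoVertexActPlace_one])
    (fun g h M => by simp only [Prod.fst_mul, map_mul, rhoVertexActPlace_mul])
    (fun M => ?_) (fun g => ?_) x hKo f hF hSV hsupp d (fun i => (E₂.symm (rU i), 1)) s (fun M hM => ?_) hs
  · -- one vertex orbit through `E₂` and the first factor
    obtain ⟨g, hg⟩ := exists_rhoVertexActPlace_onePlace_eq L v w hw hα hα0 hϖF he E₂ x₀ hx₀ M
    exact ⟨(g, 1), hg⟩
  · -- the level is the stabiliser
    rw [Subgroup.mem_prod]
    simp only [Subgroup.mem_top, and_true]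
    exact hK g.1
  · -- the shell hypothesis pulled back along `E₂`
    obtain ⟨tU, hcomm, hM⟩ := hshellU M hM
    refine ⟨(E₂.symm tU, 1), ?_, ?_⟩
    · refine Prod.ext ?_ ?_
      · dsimp only [Prod.fst_mul]
        apply E₂.injective
        rw [map_mul, map_mul, ContinuousMulEquiv.apply_symm_apply]
        exact hcomm
      · dsimp only [Prod.snd_mul]
        rw [one_mul, mul_one]
    · dsimp only [Prod.fst_mul]
      rw [map_mul, ContinuousMulEquiv.apply_symm_apply, ContinuousMulEquiv.apply_symm_apply]
      exact hM

omit [CompleteSpace E] in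
include he in
/-- **(Ψ1) DIFFERENCE FORM — the LHS of the (γ) layer's `hO`** (★ `rankOneUnstable_core_of_shellWindow`, RULING A-44): for `x, x′ ∈ H_v` (the layer's `↑t` and `e ↑t`)
whose orbital integrands live on the SAME finite vertex set with the SAME shells,
`∫ f(y x y⁻¹) dν − ∫ f(y x′ y⁻¹) dν = Σ_{i ∈ s} #{M ∈ SV | d M = i} • (f̄_i(x) − f̄_i(x′))`, `f̄_i(x) := ∫_{K × U(Φ₁)_v} f(k⁻¹ ((E₂⁻¹ (rU i), 1)⁻¹ x (E₂⁻¹ (rU i), 1)) k) dν(k)`.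
[cite: LabesseLanglands1979, §2 p. 8] [cite: Rogawski1990, §4.9 p. 54] -/
theorem integral_conj_sub_integral_conj_eq_sum_ncard_shell_smul_sub_onePlace
    (K : Subgroup ((cmDatum L 2 (Matrix.of fun i j : Fin 2 => if i.val + j.val + 1 = 2 then (1 : L) else 0)).Local v))
    (E₂ : (cmDatum L 2 (Matrix.of fun i j : Fin 2 => if i.val + j.val + 1 = 2 then (1 : L) else 0)).Local v ≃ₜ*
      ↥(unitaryGroupOfForm (galAdicCompletionMap (L := L) (IsCMField.complexConj L) hw)
        (placeForm (Matrix.of fun i j : Fin 2 => if i.val + j.val + 1 = 2 then (1 : L) else 0) w.1)))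
    (x₀ : {M : Submodule 𝒪[v.adicCompletion ↥(maximalRealSubfield L)] (Fin 2 → v.adicCompletion ↥(maximalRealSubfield L)) //
      IsSpecialLattice (RingHom.id _) ϖF !![(0 : v.adicCompletion ↥(maximalRealSubfield L)), 1; -1, 0] M})
    (hx₀ : x₀.1 = latt (1 : Matrix (Fin 2) (Fin 2) (v.adicCompletion ↥(maximalRealSubfield L))))
    (hK : ∀ g, g ∈ K ↔ rhoVertexActPlace L v w hw hα hα0 hϖF (E₂ g) x₀ = x₀)
    (hKo : IsOpen ((K.prod (⊤ : Subgroup ((cmDatum L 1 (Matrix.of fun i j : Fin 1 => if i.val + j.val + 1 = 1 then (1 : L) else 0)).Local v)) :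
      Subgroup (((cmDatum L 2 (Matrix.of fun i j : Fin 2 => if i.val + j.val + 1 = 2 then (1 : L) else 0)).Local v ×
        (cmDatum L 1 (Matrix.of fun i j : Fin 1 => if i.val + j.val + 1 = 1 then (1 : L) else 0)).Local v))) :
          Set (((cmDatum L 2 (Matrix.of fun i j : Fin 2 => if i.val + j.val + 1 = 2 then (1 : L) else 0)).Local v ×
        (cmDatum L 1 (Matrix.of fun i j : Fin 1 => if i.val + j.val + 1 = 1 then (1 : L) else 0)).Local v))))
    (x x' : ((cmDatum L 2 (Matrix.of fun i j : Fin 2 => if i.val + j.val + 1 = 2 then (1 : L) else 0)).Local v ×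
      (cmDatum L 1 (Matrix.of fun i j : Fin 1 => if i.val + j.val + 1 = 1 then (1 : L) else 0)).Local v))
    (f : (((cmDatum L 2 (Matrix.of fun i j : Fin 2 => if i.val + j.val + 1 = 2 then (1 : L) else 0)).Local v ×
      (cmDatum L 1 (Matrix.of fun i j : Fin 1 => if i.val + j.val + 1 = 1 then (1 : L) else 0)).Local v)) → E)
    (hF : Integrable (fun y : ((cmDatum L 2 (Matrix.of fun i j : Fin 2 => if i.val + j.val + 1 = 2 then (1 : L) else 0)).Local v ×
      (cmDatum L 1 (Matrix.of fun i j : Fin 1 => if i.val + j.val + 1 = 1 then (1 : L) else 0)).Local v) => f (y⁻¹ * x * y)) ν)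
    (hF' : Integrable (fun y : ((cmDatum L 2 (Matrix.of fun i j : Fin 2 => if i.val + j.val + 1 = 2 then (1 : L) else 0)).Local v ×
      (cmDatum L 1 (Matrix.of fun i j : Fin 1 => if i.val + j.val + 1 = 1 then (1 : L) else 0)).Local v) => f (y⁻¹ * x' * y)) ν)
    {SV : Set {M : Submodule 𝒪[v.adicCompletion ↥(maximalRealSubfield L)] (Fin 2 → v.adicCompletion ↥(maximalRealSubfield L)) //
      IsSpecialLattice (RingHom.id _) ϖF !![(0 : v.adicCompletion ↥(maximalRealSubfield L)), 1; -1, 0] M}} (hSV : SV.Finite)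
    (hsupp : ∀ y : ((cmDatum L 2 (Matrix.of fun i j : Fin 2 => if i.val + j.val + 1 = 2 then (1 : L) else 0)).Local v ×
      (cmDatum L 1 (Matrix.of fun i j : Fin 1 => if i.val + j.val + 1 = 1 then (1 : L) else 0)).Local v),
      f (y⁻¹ * x * y) ≠ 0 → rhoVertexActPlace L v w hw hα hα0 hϖF (E₂ y.1) x₀ ∈ SV)
    (hsupp' : ∀ y : ((cmDatum L 2 (Matrix.of fun i j : Fin 2 => if i.val + j.val + 1 = 2 then (1 : L) else 0)).Local v ×
      (cmDatum L 1 (Matrix.of fun i j : Fin 1 => if i.val + j.val + 1 = 1 then (1 : L) else 0)).Local v),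
      f (y⁻¹ * x' * y) ≠ 0 → rhoVertexActPlace L v w hw hα hα0 hϖF (E₂ y.1) x₀ ∈ SV)
    {ι : Type*} (d : {M : Submodule 𝒪[v.adicCompletion ↥(maximalRealSubfield L)] (Fin 2 → v.adicCompletion ↥(maximalRealSubfield L)) //
      IsSpecialLattice (RingHom.id _) ϖF !![(0 : v.adicCompletion ↥(maximalRealSubfield L)), 1; -1, 0] M} → ι)
    (rU : ι → ↥(unitaryGroupOfForm (galAdicCompletionMap (L := L) (IsCMField.complexConj L) hw)
      (placeForm (Matrix.of fun i j : Fin 2 => if i.val + j.val + 1 = 2 then (1 : L) else 0) w.1)))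
    (s : Finset ι)
    (hshellU : ∀ M ∈ SV, ∃ tU : ↥(unitaryGroupOfForm (galAdicCompletionMap (L := L) (IsCMField.complexConj L) hw)
        (placeForm (Matrix.of fun i j : Fin 2 => if i.val + j.val + 1 = 2 then (1 : L) else 0) w.1)),
      tU * E₂ x.1 = E₂ x.1 * tU ∧ rhoVertexActPlace L v w hw hα hα0 hϖF (tU * rU (d M)) x₀ = M)
    (hshellU' : ∀ M ∈ SV, ∃ tU : ↥(unitaryGroupOfForm (galAdicCompletionMap (L := L) (IsCMField.complexConj L) hw)
        (placeForm (Matrix.of fun i j : Fin 2 => if i.val + j.val + 1 = 2 then (1 : L) else 0) w.1)),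
      tU * E₂ x'.1 = E₂ x'.1 * tU ∧ rhoVertexActPlace L v w hw hα hα0 hϖF (tU * rU (d M)) x₀ = M)
    (hs : ∀ M ∈ SV, d M ∈ s) :
    (∫ y, f (y * x * y⁻¹) ∂ν) - ∫ y, f (y * x' * y⁻¹) ∂ν =
      ∑ i ∈ s, {M ∈ SV | d M = i}.ncard •
        ((∫ k in ((K.prod (⊤ : Subgroup ((cmDatum L 1 (Matrix.of fun i j : Fin 1 => if i.val + j.val + 1 = 1 then (1 : L) else 0)).Local v)) :
            Subgroup (((cmDatum L 2 (Matrix.of fun i j : Fin 2 => if i.val + j.val + 1 = 2 then (1 : L) else 0)).Local v ×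
              (cmDatum L 1 (Matrix.of fun i j : Fin 1 => if i.val + j.val + 1 = 1 then (1 : L) else 0)).Local v))) :
            Set (((cmDatum L 2 (Matrix.of fun i j : Fin 2 => if i.val + j.val + 1 = 2 then (1 : L) else 0)).Local v ×
              (cmDatum L 1 (Matrix.of fun i j : Fin 1 => if i.val + j.val + 1 = 1 then (1 : L) else 0)).Local v))),
          f (k⁻¹ * (((E₂.symm (rU i), (1 : (cmDatum L 1 (Matrix.of fun i j : Fin 1 => if i.val + j.val + 1 = 1 then (1 : L) else 0)).Local v)) :
              ((cmDatum L 2 (Matrix.of fun i j : Fin 2 => if i.val + j.val + 1 = 2 then (1 : L) else 0)).Local v ×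
                (cmDatum L 1 (Matrix.of fun i j : Fin 1 => if i.val + j.val + 1 = 1 then (1 : L) else 0)).Local v))⁻¹ * x *
            (E₂.symm (rU i), 1)) * k) ∂ν) -
        ∫ k in ((K.prod (⊤ : Subgroup ((cmDatum L 1 (Matrix.of fun i j : Fin 1 => if i.val + j.val + 1 = 1 then (1 : L) else 0)).Local v)) :
            Subgroup (((cmDatum L 2 (Matrix.of fun i j : Fin 2 => if i.val + j.val + 1 = 2 then (1 : L) else 0)).Local v ×
              (cmDatum L 1 (Matrix.of fun i j : Fin 1 => if i.val + j.val + 1 = 1 then (1 : L) else 0)).Local v))) :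
            Set (((cmDatum L 2 (Matrix.of fun i j : Fin 2 => if i.val + j.val + 1 = 2 then (1 : L) else 0)).Local v ×
              (cmDatum L 1 (Matrix.of fun i j : Fin 1 => if i.val + j.val + 1 = 1 then (1 : L) else 0)).Local v))),
          f (k⁻¹ * (((E₂.symm (rU i), (1 : (cmDatum L 1 (Matrix.of fun i j : Fin 1 => if i.val + j.val + 1 = 1 then (1 : L) else 0)).Local v)) :
              ((cmDatum L 2 (Matrix.of fun i j : Fin 2 => if i.val + j.val + 1 = 2 then (1 : L) else 0)).Local v ×
                (cmDatum L 1 (Matrix.of fun i j : Fin 1 => if i.val + j.val + 1 = 1 then (1 : L) else 0)).Local v))⁻¹ * x' *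
            (E₂.symm (rU i), 1)) * k) ∂ν) := by
  rw [integral_conj_eq_sum_ncard_shell_smul_onePlace L v w hw hα hα0 hϖF he ν K E₂ x₀ hx₀ hK hKo x f hF hSV hsupp d rU s hshellU hs,
    integral_conj_eq_sum_ncard_shell_smul_onePlace L v w hw hα hα0 hϖF he ν K E₂ x₀ hx₀ hK hKo x' f hF' hSV hsupp' d rU s hshellU' hs,
    ← Finset.sum_sub_distrib]
  exact Finset.sum_congr rfl fun i _ => (smul_sub _ _ _).symm

end GeneralTestFunction

end Literature.NumberTheory.Rogawski1990

end
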